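import Literature.RepresentationTheory.GeneralLinear.OrbitLatticeProbes
import HarnessLib

/-!
# Intertwiners of `k[Δ f]_d` versus divided powers, weight components and integral lattices

Fourth file of the `hyperalgebraCoinvariants` cluster (route ValiantsHypothesis/IntegralGCT).
For a `GL_σ(k)`-intertwiner `φ : k[Δ f₁]_d → k[Δ f₂]_d` over an INFINITE field `k`:

* `coordSubst_transvectionGL_eq_sum`: `u_ij(c) · F = Σ_l c^l E_ij^(l) F` (Taylor expansion);
* `intertwining_divPow`: `φ [F] = [G] ⟹ φ [E_ij^(l) F] = [E_ij^(l) G]` — expand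
  `φ (u_ij(c)·[F]) = u_ij(c)·[G]` at `deg + 1` points and extract coefficients (Vandermonde);
* `intertwining_probeComponent`: likewise `φ [F_{(l)}] = [G_{(l)}]` for probe components, using
  the weight probes `π_B(c)` (`infinite_units`: enough units);
* the induced map of integral lattices when `φ` maps `Λ(f₁,d)` onto `Λ(f₂,d)` (the hypothesis is
  the literal set equation of the route's cruxes): `LatticeRel φ F G` ("`φ [F] = [G]`"),
  `exists_latticeRel` / `exists_latticeRel'` (into / onto), `latticeMap φ hφ : Λ_{f₁,d} →ₗ[ℤ]
  Λ_{f₂,d}` (well defined by `latticeMk_eq_of_toDeg_eq`), `latticeMap_mk`, `latticeRel_divPow`.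

[folklore] throughout (equivariant maps commute with the hyperalgebra: Jantzen 2003 I.7.11).
-/

noncomputable section

namespace Literature.RepresentationTheory.GeneralLinear

open MvPolynomial Literature.Computability.AlgebraicComplexity Representation
open scoped Polynomial

section Expansion

variable {σ : Type*} [Fintype σ] [DecidableEq σ] {R : Type*} [CommRing R]

/-- The generic transvection orbit of `F`: `u_ij(t) · (F ⊗ 1) ∈ R[t][V]`. [folklore] -/
abbrev transvectionOrbit (m : ℕ) {i j : σ} (h : i ≠ j) (F : MvPolynomial (DegIdx σ m) R) :
    MvPolynomial (DegIdx σ m) R[X] :=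
  coordSubst m (transvectionGL h (Polynomial.X : R[X])) (map (algebraMap R R[X]) F)

/-- **Taylor expansion of a transvection**: `u_ij(c) · F = Σ_l c^l E_ij^(l) F`.
[cite: Jantzen2003, I.7.8 and II.1.12] -/
theorem coordSubst_transvectionGL_eq_sum (m : ℕ) {i j : σ} (h : i ≠ j) (c : R)
    (F : MvPolynomial (DegIdx σ m) R) {D : ℕ} (hD : tDegreeBound (transvectionOrbit m h F) ≤ D) :
    coordSubst m (transvectionGL h c) F =
      ∑ l ∈ Finset.range (D + 1), c ^ l • coordDivPow m i j l F := by
  have hcomp : (Polynomial.evalRingHom c).comp (algebraMap R R[X]) = RingHom.id R := by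
    ext x; simp
  have key : coordSubst m (transvectionGL h c) F =
      map (Polynomial.evalRingHom c) (transvectionOrbit m h F) := by
    rw [transvectionOrbit, map_coordSubst, generalLinearGroup_map_transvectionGL, map_map,
      Polynomial.coe_evalRingHom, Polynomial.eval_X, hcomp, map_id]
  rw [key, map_evalRingHom_eq_sum _ c hD]
  simp_rw [coordDivPow_apply m h]

end Expansion

section Intertwine

variable {σ : Type*} [Fintype σ] [DecidableEq σ] {k : Type*} [Field k]

/-- The unit group of an infinite field is infinite. [folklore] -/
theorem infinite_units [Infinite k] : Infinite kˣ := by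
  have h : Set.Infinite ({0}ᶜ : Set k) := (Set.finite_singleton (0 : k)).infinite_compl
  have : Infinite ({0}ᶜ : Set k) := h.to_subtype
  refine Infinite.of_injective (fun a : ({0}ᶜ : Set k) => Units.mk0 (a : k) a.2) fun a b hab => ?_
  exact Subtype.ext (by simpa using congrArg Units.val hab)

variable {f₁ f₂ : MvPolynomial σ k} {m d : ℕ}

/-- Sums and scalars pass through `toDeg` on bundled forms. [folklore] -/
theorem toDeg_mk_sum (f : MvPolynomial σ k) (s : Finset ℕ) (c : ℕ → k)
    (H : ℕ → homogeneousSubmodule (DegIdx σ m) k d) (G : MvPolynomial (DegIdx σ m) k)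
    (hG : G ∈ homogeneousSubmodule (DegIdx σ m) k d)
    (hsum : G = ∑ l ∈ s, c l • (H l : MvPolynomial (DegIdx σ m) k)) :
    toDeg f m d ⟨G, hG⟩ = ∑ l ∈ s, c l • toDeg f m d (H l) := by
  have : (⟨G, hG⟩ : homogeneousSubmodule (DegIdx σ m) k d) = ∑ l ∈ s, c l • H l :=
    Subtype.ext (by simp only [Submodule.coe_sum, Submodule.coe_smul]; exact hsum)
  rw [this, map_sum]
  simp_rw [map_smul]

/-- **Intertwiners commute with the divided powers** on classes of forms: if `φ [F] = [G]` then
`φ [E_ij^(l) F] = [E_ij^(l) G]` (expand `φ (u_ij(c) · [F]) = u_ij(c) · [G]` in powers of `c` at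
`deg + 1` points of the infinite field). [cite: Jantzen2003, I.7.8 and II.1.12] -/
theorem intertwining_divPow [Infinite k]
    (φ : IntertwiningMap (orbitCoordRepDeg f₁ m d) (orbitCoordRepDeg f₂ m d))
    {F G : homogeneousSubmodule (DegIdx σ m) k d} (h : φ (toDeg f₁ m d F) = toDeg f₂ m d G)
    (i j : σ) (l : ℕ) :
    φ (toDeg f₁ m d ((coordKostantModuleDeg σ k m d).divPow i j l F)) =
      toDeg f₂ m d ((coordKostantModuleDeg σ k m d).divPow i j l G) := by
  by_cases hij : i = j
  · subst hij
    have h0 : ∀ H : homogeneousSubmodule (DegIdx σ m) k d,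
        (coordKostantModuleDeg σ k m d).divPow i i l H = 0 := fun H =>
      Subtype.ext (by
        change coordDivPow m i i l (H : MvPolynomial (DegIdx σ m) k) = 0
        rw [coordDivPow_self, LinearMap.zero_apply])
    simp only [h0, map_zero]
  -- degree bound and nodes
  set D := max (tDegreeBound (transvectionOrbit m hij (F : MvPolynomial (DegIdx σ m) k)))
    (tDegreeBound (transvectionOrbit m hij (G : MvPolynomial (DegIdx σ m) k))) with hD
  let c : Fin (D + 1) → k := fun n => Infinite.natEmbedding k n
  have hc : Function.Injective c := fun a b hab =>
    Fin.ext (by exact_mod_cast (Infinite.natEmbedding k).injective hab)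
  -- the differences
  let w : ℕ → orbitCoordRingDeg f₂ m d := fun l =>
    φ (toDeg f₁ m d ((coordKostantModuleDeg σ k m d).divPow i j l F)) -
      toDeg f₂ m d ((coordKostantModuleDeg σ k m d).divPow i j l G)
  have hexp : ∀ (f : MvPolynomial σ k) (H : homogeneousSubmodule (DegIdx σ m) k d)
      (hH : tDegreeBound (transvectionOrbit m hij (H : MvPolynomial (DegIdx σ m) k)) ≤ D) (x : k),
      orbitCoordRepDeg f m d (transvectionGL hij x) (toDeg f m d H) =
        ∑ l ∈ Finset.range (D + 1),
          x ^ l • toDeg f m d ((coordKostantModuleDeg σ k m d).divPow i j l H) := by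
    intro f H hH x
    rw [orbitCoordRepDeg_toDeg]
    exact toDeg_mk_sum f _ _ _ _ _ (coordSubst_transvectionGL_eq_sum m hij x _ hH)
  have hzero : ∀ n : Fin (D + 1),
      ∑ l ∈ Finset.range (D + 1), c n ^ l • w l ∈ (⊥ : Submodule k _) := by
    intro n
    rw [Submodule.mem_bot]
    simp only [w, smul_sub, Finset.sum_sub_distrib]
    rw [← hexp f₂ G (le_max_right _ _), ← h, ← φ.isIntertwining, hexp f₁ F (le_max_left _ _),
      map_sum]
    simp_rw [map_smul]
    exact sub_self _
  by_cases hl : l ≤ D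
  · have := mem_of_sum_pow_smul_mem ⊥ w c hc hzero (Nat.lt_succ_of_le hl)
    rwa [Submodule.mem_bot, sub_eq_zero] at this
  · replace hl := not_le.mp hl
    have hv : ∀ (H : homogeneousSubmodule (DegIdx σ m) k d),
        tDegreeBound (transvectionOrbit m hij (H : MvPolynomial (DegIdx σ m) k)) < l →
        (coordKostantModuleDeg σ k m d).divPow i j l H = 0 := fun H hH =>
      Subtype.ext (by
        change coordDivPow m i j l (H : MvPolynomial (DegIdx σ m) k) = 0
        rw [coordDivPow_apply m hij]
        exact tCoeff_eq_zero_of_lt _ hH)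
    simp only [hv F ((le_max_left _ _).trans_lt hl), hv G ((le_max_right _ _).trans_lt hl),
      map_zero]

variable (k) in
/-- The probe component operator on degree-`d` coordinate forms. [folklore] -/
def probeComponent (m d B l : ℕ) :
    homogeneousSubmodule (DegIdx σ m) k d →ₗ[k] homogeneousSubmodule (DegIdx σ m) k d :=
  (weightedHomogeneousComponent (probeWeight B m) l).restrict fun F hF =>
    (mem_homogeneousSubmodule d _).2
      (isHomogeneous_weightedHomogeneousComponent _ _ ((mem_homogeneousSubmodule d F).1 hF))

/-- `probeComponent` on representatives. [folklore] -/
@[simp] theorem coe_probeComponent (m d B l : ℕ) (F : homogeneousSubmodule (DegIdx σ m) k d) :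
    ((probeComponent k m d B l F : homogeneousSubmodule (DegIdx σ m) k d) :
      MvPolynomial (DegIdx σ m) k) = weightedHomogeneousComponent (probeWeight B m) l F := rfl

/-- **Intertwiners commute with the probe components**: if `φ [F] = [G]` then
`φ [F_{(l)}] = [G_{(l)}]` for the probe-weight components (expand `φ (π(c) · [F]) = π(c) · [G]`).
[folklore] -/
theorem intertwining_probeComponent [Infinite k]
    (φ : IntertwiningMap (orbitCoordRepDeg f₁ m d) (orbitCoordRepDeg f₂ m d))
    {F G : homogeneousSubmodule (DegIdx σ m) k d} (h : φ (toDeg f₁ m d F) = toDeg f₂ m d G)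
    (B l : ℕ) :
    φ (toDeg f₁ m d (probeComponent k m d B l F)) = toDeg f₂ m d (probeComponent k m d B l G) := by
  classical
  haveI : Infinite kˣ := infinite_units
  set D := ((F : MvPolynomial (DegIdx σ m) k).support ∪
    (G : MvPolynomial (DegIdx σ m) k).support).sup (Finsupp.weight (probeWeight B m)) with hD
  have hDF : ∀ n ∈ (F : MvPolynomial (DegIdx σ m) k).support,
      Finsupp.weight (probeWeight B m) n ≤ D := fun n hn =>
    Finset.le_sup (f := Finsupp.weight (probeWeight B m)) (Finset.mem_union_left _ hn)
  have hDG : ∀ n ∈ (G : MvPolynomial (DegIdx σ m) k).support,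
      Finsupp.weight (probeWeight B m) n ≤ D := fun n hn =>
    Finset.le_sup (f := Finsupp.weight (probeWeight B m)) (Finset.mem_union_right _ hn)
  let c : Fin (D + 1) → kˣ := fun n => Infinite.natEmbedding kˣ n
  have hc : Function.Injective (fun n => (c n : k)) := fun a b hab =>
    Fin.ext (by exact_mod_cast (Infinite.natEmbedding kˣ).injective (Units.val_injective hab))
  let w : ℕ → orbitCoordRingDeg f₂ m d := fun l =>
    φ (toDeg f₁ m d (probeComponent k m d B l F)) - toDeg f₂ m d (probeComponent k m d B l G)
  have hexp : ∀ (f : MvPolynomial σ k) (H : homogeneousSubmodule (DegIdx σ m) k d)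
      (hH : ∀ n ∈ (H : MvPolynomial (DegIdx σ m) k).support, Finsupp.weight (probeWeight B m) n ≤ D)
      (x : kˣ),
      orbitCoordRepDeg f m d (weightProbe B x) (toDeg f m d H) =
        ∑ l ∈ Finset.range (D + 1), (x : k) ^ l • toDeg f m d (probeComponent k m d B l H) := by
    intro f H hH x
    rw [orbitCoordRepDeg_toDeg]
    exact toDeg_mk_sum f _ _ _ _ _ (coordSubst_weightProbe_eq_sum m B x _ hH)
  have hzero : ∀ n : Fin (D + 1),
      ∑ l ∈ Finset.range (D + 1), (c n : k) ^ l • w l ∈ (⊥ : Submodule k _) := by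
    intro n
    rw [Submodule.mem_bot]
    simp only [w, smul_sub, Finset.sum_sub_distrib]
    rw [← hexp f₂ G hDG, ← h, ← φ.isIntertwining, hexp f₁ F hDF, map_sum]
    simp_rw [map_smul]
    exact sub_self _
  by_cases hl : l ≤ D
  · have := mem_of_sum_pow_smul_mem ⊥ w (fun n => (c n : k)) hc hzero (Nat.lt_succ_of_le hl)
    rwa [Submodule.mem_bot, sub_eq_zero] at this
  · replace hl := not_le.mp hl
    have hv : ∀ (H : homogeneousSubmodule (DegIdx σ m) k d),
        (∀ n ∈ (H : MvPolynomial (DegIdx σ m) k).support,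
          Finsupp.weight (probeWeight B m) n ≤ D) →
        probeComponent k m d B l H = 0 := fun H hH =>
      Subtype.ext (by
        rw [coe_probeComponent, Submodule.coe_zero]
        exact weightedHomogeneousComponent_eq_zero' _ _
          (fun n hn heq => absurd ((hH n hn).trans_lt hl) (by rw [heq]; exact lt_irrefl _)))
    simp only [hv F hDF, hv G hDG, map_zero]

end Intertwine

end Literature.RepresentationTheory.GeneralLinear

namespace Literature.RepresentationTheory.GeneralLinear

open MvPolynomial Literature.Computability.AlgebraicComplexity Representation
open scoped Polynomial


section LatticeHom

variable {σ : Type*} [Fintype σ] [DecidableEq σ] {k : Type*} [Field k]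
variable {f₁ f₂ : MvPolynomial σ k} {m d : ℕ}

/-- Integer degree-`d` forms as degree-`d` forms over `k`. [folklore] -/
def intHom (k) [Field k] (m d : ℕ) (F : homogeneousSubmodule (DegIdx σ m) ℤ d) :
    homogeneousSubmodule (DegIdx σ m) k d :=
  ⟨map (Int.castRingHom k) F,
    (mem_homogeneousSubmodule d _).2 (((mem_homogeneousSubmodule d _).1 F.2).map _)⟩

/-- `intHom` on representatives. [folklore] -/
@[simp] theorem coe_intHom (F : homogeneousSubmodule (DegIdx σ m) ℤ d) :
    ((intHom k m d F : homogeneousSubmodule (DegIdx σ m) k d) : MvPolynomial (DegIdx σ m) k) =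
      map (Int.castRingHom k) F := rfl

/-- `intHom` is additive. [folklore] -/
theorem intHom_add (F F' : homogeneousSubmodule (DegIdx σ m) ℤ d) :
    intHom k m d (F + F') = intHom k m d F + intHom k m d F' :=
  Subtype.ext (by simp [map_add])

/-- `intHom` is `ℤ`-linear. [folklore] -/
theorem intHom_zsmul (z : ℤ) (F : homogeneousSubmodule (DegIdx σ m) ℤ d) :
    intHom k m d (z • F) = z • intHom k m d F :=
  Subtype.ext (by simp)

/-- The relation "`φ [F] = [G]`" between an integer form `F` for `f₁` and an integer form `G` for
`f₂`. [folklore] -/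
def LatticeRel (φ : IntertwiningMap (orbitCoordRepDeg f₁ m d) (orbitCoordRepDeg f₂ m d))
    (F G : homogeneousSubmodule (DegIdx σ m) ℤ d) : Prop :=
  φ (toDeg f₁ m d (intHom k m d F)) = toDeg f₂ m d (intHom k m d G)

/-- The class of an integer degree-`d` form in `Λ_{f,d} = ℤ[V]_d ⧸ K_{f,d}`. [folklore] -/
def latticeMk (f : MvPolynomial σ k) (m d : ℕ) :
    homogeneousSubmodule (DegIdx σ m) ℤ d →ₗ[ℤ] OrbitLatticeDeg f m d :=
  (orbitLatticeKerDeg f m d).mkQ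

/-- Unfolding `latticeMk`. [folklore] -/
theorem latticeMk_apply (f : MvPolynomial σ k) (G : homogeneousSubmodule (DegIdx σ m) ℤ d) :
    latticeMk f m d G = Submodule.Quotient.mk G := rfl

/-- Two integer forms with the same class in `k[Δ f]` have the same class in `Λ_{f,d}`.
[folklore] -/
theorem latticeMk_eq_of_toDeg_eq (f : MvPolynomial σ k)
    {G G' : homogeneousSubmodule (DegIdx σ m) ℤ d}
    (h : toDeg f m d (intHom k m d G) = toDeg f m d (intHom k m d G')) :
    latticeMk f m d G = latticeMk f m d G' := by
  rw [latticeMk_apply, latticeMk_apply, Submodule.Quotient.eq, orbitLatticeKerDeg,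
    Submodule.mem_comap, Submodule.subtype_apply, mem_orbitLatticeKer_iff, Submodule.coe_sub,
    map_sub, ← Ideal.Quotient.eq]
  exact congrArg (fun x : orbitCoordRingDeg f m d => (x : OrbitCoordRing f m)) h

variable (φ : IntertwiningMap (orbitCoordRepDeg f₁ m d) (orbitCoordRepDeg f₂ m d))
  (hφ : (fun x => ((φ x : orbitCoordRingDeg f₂ m d) : OrbitCoordRing f₂ m)) ''
      {x | ∃ F : MvPolynomial (DegIdx σ m) ℤ, F.IsHomogeneous d ∧
        Ideal.Quotient.mk (orbitVanishingIdeal f₁ m) (map (Int.castRingHom k) F) =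
          (x : OrbitCoordRing f₁ m)} =
    {y | ∃ F : MvPolynomial (DegIdx σ m) ℤ, F.IsHomogeneous d ∧
      Ideal.Quotient.mk (orbitVanishingIdeal f₂ m) (map (Int.castRingHom k) F) = y})

include hφ in
/-- Lattice INTO lattice: every integer class maps to an integer class. [folklore] -/
theorem exists_latticeRel (F : homogeneousSubmodule (DegIdx σ m) ℤ d) :
    ∃ G : homogeneousSubmodule (DegIdx σ m) ℤ d, LatticeRel φ F G := by
  have hx : ((φ (toDeg f₁ m d (intHom k m d F)) : orbitCoordRingDeg f₂ m d) : OrbitCoordRing f₂ m) ∈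
      {y | ∃ F : MvPolynomial (DegIdx σ m) ℤ, F.IsHomogeneous d ∧
        Ideal.Quotient.mk (orbitVanishingIdeal f₂ m) (map (Int.castRingHom k) F) = y} := by
    rw [← hφ]
    exact ⟨toDeg f₁ m d (intHom k m d F), ⟨F, (mem_homogeneousSubmodule d _).1 F.2, rfl⟩, rfl⟩
  obtain ⟨G, hG, hGe⟩ := hx
  exact ⟨⟨G, (mem_homogeneousSubmodule d _).2 hG⟩, Subtype.ext hGe.symm⟩

include hφ in
/-- Lattice ONTO lattice: every integer class is hit by an integer class. [folklore] -/
theorem exists_latticeRel' (G : homogeneousSubmodule (DegIdx σ m) ℤ d) :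
    ∃ F : homogeneousSubmodule (DegIdx σ m) ℤ d, LatticeRel φ F G := by
  have hy : Ideal.Quotient.mk (orbitVanishingIdeal f₂ m) (map (Int.castRingHom k) G) ∈
      (fun x => ((φ x : orbitCoordRingDeg f₂ m d) : OrbitCoordRing f₂ m)) ''
        {x | ∃ F : MvPolynomial (DegIdx σ m) ℤ, F.IsHomogeneous d ∧
          Ideal.Quotient.mk (orbitVanishingIdeal f₁ m) (map (Int.castRingHom k) F) =
            (x : OrbitCoordRing f₁ m)} := by
    rw [hφ]
    exact ⟨G, (mem_homogeneousSubmodule d _).1 G.2, rfl⟩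
  obtain ⟨x, ⟨F, hF, hFx⟩, hxG⟩ := hy
  refine ⟨⟨F, (mem_homogeneousSubmodule d _).2 hF⟩, ?_⟩
  have hx : toDeg f₁ m d (intHom k m d ⟨F, (mem_homogeneousSubmodule d _).2 hF⟩) = x :=
    Subtype.ext hFx
  show φ (toDeg f₁ m d _) = toDeg f₂ m d _
  rw [hx]
  exact Subtype.ext hxG

/-- The lattice map underlying the morphism: `F ↦ [G]` for any `G` with `φ [F] = [G]`.
[folklore] -/
def latticeMapFun (F : homogeneousSubmodule (DegIdx σ m) ℤ d) : OrbitLatticeDeg f₂ m d :=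
  latticeMk f₂ m d (Classical.choose (exists_latticeRel φ hφ F))

/-- `latticeMapFun F = [G]` for ANY witness `G`. [folklore] -/
theorem latticeMapFun_eq {F G : homogeneousSubmodule (DegIdx σ m) ℤ d} (h : LatticeRel φ F G) :
    latticeMapFun φ hφ F = latticeMk f₂ m d G :=
  latticeMk_eq_of_toDeg_eq f₂ ((Classical.choose_spec (exists_latticeRel φ hφ F)).symm.trans h)

/-- The relation is additive. [folklore] -/
theorem latticeRel_add {F F' G G' : homogeneousSubmodule (DegIdx σ m) ℤ d} (h : LatticeRel φ F G)
    (h' : LatticeRel φ F' G') : LatticeRel φ (F + F') (G + G') := by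
  simp only [LatticeRel, intHom_add, map_add] at *
  rw [h, h']

/-- The relation is `ℤ`-homogeneous. [folklore] -/
theorem latticeRel_zsmul (z : ℤ) {F G : homogeneousSubmodule (DegIdx σ m) ℤ d}
    (h : LatticeRel φ F G) : LatticeRel φ (z • F) (z • G) := by
  simp only [LatticeRel, intHom_zsmul, map_zsmul] at *
  rw [h]

/-- The lattice map `ℤ[V]_d → Λ_{f₂,d}` as a `ℤ`-linear map. [folklore] -/
def latticeMapLinear : homogeneousSubmodule (DegIdx σ m) ℤ d →ₗ[ℤ] OrbitLatticeDeg f₂ m d where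
  toFun := latticeMapFun φ hφ
  map_add' F F' := by
    obtain ⟨G, hG⟩ := exists_latticeRel φ hφ F
    obtain ⟨G', hG'⟩ := exists_latticeRel φ hφ F'
    rw [latticeMapFun_eq φ hφ (latticeRel_add φ hG hG'), latticeMapFun_eq φ hφ hG,
      latticeMapFun_eq φ hφ hG', map_add]
  map_smul' z F := by
    obtain ⟨G, hG⟩ := exists_latticeRel φ hφ F
    rw [latticeMapFun_eq φ hφ (latticeRel_zsmul φ z hG), latticeMapFun_eq φ hφ hG, map_zsmul,
      RingHom.id_apply]

/-- `latticeMapLinear F = [G]` for any witness. [folklore] -/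
theorem latticeMapLinear_eq {F G : homogeneousSubmodule (DegIdx σ m) ℤ d} (h : LatticeRel φ F G) :
    latticeMapLinear φ hφ F = latticeMk f₂ m d G :=
  latticeMapFun_eq φ hφ h

/-- `K_{f₁,d}` dies. [folklore] -/
theorem orbitLatticeKerDeg_le_ker :
    orbitLatticeKerDeg f₁ m d ≤ LinearMap.ker (latticeMapLinear φ hφ) := by
  intro F hF
  rw [LinearMap.mem_ker]
  have h0 : LatticeRel φ F 0 := by
    have hF0 : toDeg f₁ m d (intHom k m d F) = 0 := Subtype.ext (by
      rw [coe_toDeg, coe_intHom]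
      exact (Ideal.Quotient.eq_zero_iff_mem.2 ((mem_orbitLatticeKer_iff f₁ m _).1 hF)))
    rw [LatticeRel, hF0, map_zero]
    exact Subtype.ext (by simp [map_zero])
  rw [latticeMapLinear_eq φ hφ h0, map_zero]

/-- **The morphism of lattices `Λ_{f₁,d} → Λ_{f₂,d}` induced by a lattice-preserving intertwiner.**
[folklore] -/
def latticeMap : OrbitLatticeDeg f₁ m d →ₗ[ℤ] OrbitLatticeDeg f₂ m d :=
  (orbitLatticeKerDeg f₁ m d).liftQ (latticeMapLinear φ hφ) (orbitLatticeKerDeg_le_ker φ hφ)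

/-- `latticeMap [F] = [G]` whenever `φ [F] = [G]`. [folklore] -/
theorem latticeMap_mk {F G : homogeneousSubmodule (DegIdx σ m) ℤ d} (h : LatticeRel φ F G) :
    latticeMap φ hφ (latticeMk f₁ m d F) = latticeMk f₂ m d G :=
  latticeMapLinear_eq φ hφ h

variable [Infinite k]

/-- The relation is compatible with the divided powers. [folklore] -/
theorem latticeRel_divPow {F G : homogeneousSubmodule (DegIdx σ m) ℤ d} (h : LatticeRel φ F G)
    (i j : σ) (l : ℕ) :
    LatticeRel φ ((coordKostantModuleDeg σ ℤ m d).divPow i j l F)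
      ((coordKostantModuleDeg σ ℤ m d).divPow i j l G) := by
  have hint : ∀ H : homogeneousSubmodule (DegIdx σ m) ℤ d,
      intHom k m d ((coordKostantModuleDeg σ ℤ m d).divPow i j l H) =
        (coordKostantModuleDeg σ k m d).divPow i j l (intHom k m d H) := fun H =>
    Subtype.ext (map_coordDivPow (Int.castRingHom k) m i j l (H : MvPolynomial (DegIdx σ m) ℤ))
  rw [LatticeRel, hint, hint]
  exact intertwining_divPow φ h i j l

end LatticeHom

end Literature.RepresentationTheory.GeneralLinear
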